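import Literature.Topology.FourManifolds.HandleAttachingMaps
import Literature.Topology.FourManifolds.ClosedBallSmoothMaps
import Mathlib.Analysis.SpecialFunctions.Sqrt
import Mathlib.Analysis.InnerProductSpace.Calculus
import Mathlib.Geometry.Manifold.Instances.Sphere
import HarnessLib

/-!
# Coordinates on Kosinski's tube `T` of a 2-handle in arbitrary dimension `m + 2`

Topic `Literature/Topology/FourManifolds`; infrastructure below `HandleAttachingMaps.lean`
(Kosinski's tube `T = {x ∈ D^{m+2} | x_λ ≠ 0}` of the attaching circle
`S = {|x_λ| = 1, x_μ = 0}` of a 2-handle, `handleTube (m + 1) 2`; Kosinski, *Differential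
Manifolds* (1993), VI §6, with the projection `x ↦ x_λ/|x_λ|` onto `S`).  The tree has these
coordinates for `m = 2` (2-handles on 4-manifolds: `HandleAttachingMapOfTube.lean`,
`HandleTubeDepthField.lean`); this file is the dimension-generic version needed for 2-handles
on 5-manifolds (`PresentationHandlebodyFive*.lean`, roadmap brick K: the attaching map of a
2-handle built from a tube of a circle in `∂V` prolonged along a collar, Kosinski III §4) and
beyond:

* §1 the splitting `ℝ^{m+2} = ℝ²_λ × ℝᵐ_μ` as continuous linear maps `lamPart₂`, `muPartG`,
  `lamEmbed₂`, `muEmbedG` with their algebra (`lamEmbed₂_lamPart₂_add_muEmbedG_muPartG`,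
  `norm_sq_eq_lamPart₂_muPartG`, `lamSq_two_eq`, `muSq_two_eq`, …);
* §2 the three coordinates of a point of `T`: `tubeAngleG y = x_λ/|x_λ| ∈ S¹`,
  `tubeFibreG y = x_μ ∈ ℝᵐ` (`‖x_μ‖ < 1`), `tubeDepthG y = 1 - ‖x‖² ∈ [0, 1)` (vanishing
  exactly on `T ∩ ∂D^{m+2}`), all smooth on the manifold with boundary `T`;
* §3 reconstruction: `mkVecG θ v s = (1 - s - ‖v‖²)^{1/2} (θ, 0) + (0, v)`, `mkTubePtG`, the
  identities `tubeAngleG (mkTubePtG θ v s) = θ` etc. and `mkVecG_tube`, and the smoothness of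
  `mkVecG` along smooth data (`contMDiffOn_mkVecG`).

Everything here is proved; the definitions are explicit coordinate formulas.

## References

* A. A. Kosinski, *Differential Manifolds*, Academic Press (1993), VI §6; III §4. [Kosinski1993]
-/

open scoped Manifold ContDiff Topology RealInnerProductSpace
open Set Function Metric Topology

noncomputable section

namespace Literature.Topology.FourManifolds

universe u

/-- Local notation: `𝔼 n` is the model Euclidean space `EuclideanSpace ℝ (Fin n)`. -/
local notation "𝔼 " n:arg => EuclideanSpace ℝ (Fin n)

/-- Local notation: `𝕊 n` is the unit sphere in `EuclideanSpace ℝ (Fin (n + 1))`. -/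
local notation "𝕊 " n:arg => (Metric.sphere (0 : EuclideanSpace ℝ (Fin (n + 1))) 1)

/-- Local notation: `𝔻 n` is the closed unit ball in `EuclideanSpace ℝ (Fin n)`. -/
local notation "𝔻 " n:arg => (Metric.closedBall (0 : EuclideanSpace ℝ (Fin n)) 1)

attribute [local instance] fact_finrank_euclideanSpace_succ

/-! ### §1 The splitting `ℝ^{m+2} = ℝ²_λ × ℝᵐ_μ` -/

section Splitting

variable {m : ℕ}

/-- The `λ`-part `x_λ = (x₀, x₁) ∈ ℝ²` of `x ∈ ℝ^{m+2}`, as a linear map. [cite: Kosinski1993, VI §6] -/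
def lamPart₂ₗ (m : ℕ) : 𝔼 (m + 2) →ₗ[ℝ] 𝔼 2 where
  toFun x := WithLp.toLp 2 fun i : Fin 2 => x ⟨i.val, by omega⟩
  map_add' x y := by ext i; simp
  map_smul' c x := by ext i; simp

/-- **The `λ`-part** `x_λ = (x₀, x₁)` of `x ∈ ℝ^{m+2}`. [cite: Kosinski1993, VI §6] -/
def lamPart₂ (m : ℕ) : 𝔼 (m + 2) →L[ℝ] 𝔼 2 := LinearMap.toContinuousLinearMap (lamPart₂ₗ m)

/-- Coordinates of the `λ`-part. [folklore] -/
@[simp] theorem lamPart₂_apply (x : 𝔼 (m + 2)) (i : Fin 2) :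
    lamPart₂ m x i = x ⟨i.val, by omega⟩ := rfl

/-- The `μ`-part `x_μ = (x₂, …, x_{m+1}) ∈ ℝᵐ` of `x ∈ ℝ^{m+2}`, as a linear map.
[cite: Kosinski1993, VI §6] -/
def muPartGₗ (m : ℕ) : 𝔼 (m + 2) →ₗ[ℝ] 𝔼 m where
  toFun x := WithLp.toLp 2 fun j : Fin m => x ⟨j.val + 2, by omega⟩
  map_add' x y := by ext i; simp
  map_smul' c x := by ext i; simp

/-- **The `μ`-part** `x_μ = (x₂, …, x_{m+1})` of `x ∈ ℝ^{m+2}`. [cite: Kosinski1993, VI §6] -/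
def muPartG (m : ℕ) : 𝔼 (m + 2) →L[ℝ] 𝔼 m := LinearMap.toContinuousLinearMap (muPartGₗ m)

/-- Coordinates of the `μ`-part. [folklore] -/
@[simp] theorem muPartG_apply (x : 𝔼 (m + 2)) (j : Fin m) :
    muPartG m x j = x ⟨j.val + 2, by omega⟩ := rfl

/-- The inclusion `ℝ²_λ ↪ ℝ^{m+2}`, `u ↦ (u₀, u₁, 0, …, 0)`, as a linear map. [cite: Kosinski1993, VI §6] -/
def lamEmbed₂ₗ (m : ℕ) : 𝔼 2 →ₗ[ℝ] 𝔼 (m + 2) where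
  toFun u := WithLp.toLp 2 fun i : Fin (m + 2) => if h : i.val < 2 then u ⟨i.val, h⟩ else 0
  map_add' u v := by
    ext i
    simp only [PiLp.add_apply]
    split_ifs <;> simp
  map_smul' c u := by
    ext i
    simp only [PiLp.smul_apply, smul_eq_mul, RingHom.id_apply]
    split_ifs <;> simp

/-- **The inclusion `ℝ²_λ ↪ ℝ^{m+2}`.** [cite: Kosinski1993, VI §6] -/
def lamEmbed₂ (m : ℕ) : 𝔼 2 →L[ℝ] 𝔼 (m + 2) := LinearMap.toContinuousLinearMap (lamEmbed₂ₗ m)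

/-- Coordinates of `lamEmbed₂ u`. [folklore] -/
theorem lamEmbed₂_apply (u : 𝔼 2) (i : Fin (m + 2)) :
    lamEmbed₂ m u i = if h : i.val < 2 then u ⟨i.val, h⟩ else 0 := rfl

/-- The inclusion `ℝᵐ_μ ↪ ℝ^{m+2}`, `v ↦ (0, 0, v₀, …, v_{m-1})`, as a linear map.
[cite: Kosinski1993, VI §6] -/
def muEmbedGₗ (m : ℕ) : 𝔼 m →ₗ[ℝ] 𝔼 (m + 2) where
  toFun v := WithLp.toLp 2 fun i : Fin (m + 2) =>
    if h : 2 ≤ i.val then v ⟨i.val - 2, by omega⟩ else 0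
  map_add' u v := by
    ext i
    simp only [PiLp.add_apply]
    split_ifs <;> simp
  map_smul' c u := by
    ext i
    simp only [PiLp.smul_apply, smul_eq_mul, RingHom.id_apply]
    split_ifs <;> simp

/-- **The inclusion `ℝᵐ_μ ↪ ℝ^{m+2}`.** [cite: Kosinski1993, VI §6] -/
def muEmbedG (m : ℕ) : 𝔼 m →L[ℝ] 𝔼 (m + 2) := LinearMap.toContinuousLinearMap (muEmbedGₗ m)

/-- Coordinates of `muEmbedG v`. [folklore] -/
theorem muEmbedG_apply (v : 𝔼 m) (i : Fin (m + 2)) :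
    muEmbedG m v i = if h : 2 ≤ i.val then v ⟨i.val - 2, by omega⟩ else 0 := rfl

/-- `lamPart (lamEmbed u) = u`. [folklore] -/
@[simp] theorem lamPart₂_lamEmbed₂ (u : 𝔼 2) : lamPart₂ m (lamEmbed₂ m u) = u := by
  ext i
  rw [lamPart₂_apply, lamEmbed₂_apply, dif_pos (by exact i.isLt)]

/-- `lamPart (muEmbed v) = 0`. [folklore] -/
@[simp] theorem lamPart₂_muEmbedG (v : 𝔼 m) : lamPart₂ m (muEmbedG m v) = 0 := by
  ext i
  rw [lamPart₂_apply, muEmbedG_apply, dif_neg (by have := i.isLt; simp only [not_le]; omega)]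
  rfl

/-- `muPart (lamEmbed u) = 0`. [folklore] -/
@[simp] theorem muPartG_lamEmbed₂ (u : 𝔼 2) : muPartG m (lamEmbed₂ m u) = 0 := by
  ext j
  rw [muPartG_apply, lamEmbed₂_apply, dif_neg (by simp)]
  rfl

/-- `muPart (muEmbed v) = v`. [folklore] -/
@[simp] theorem muPartG_muEmbedG (v : 𝔼 m) : muPartG m (muEmbedG m v) = v := by
  ext j
  rw [muPartG_apply, muEmbedG_apply, dif_pos (by simp)]
  exact congrArg v (Fin.ext (by simp))

/-- **`x = (x_λ, 0) + (0, x_μ)`.** [folklore] -/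
theorem lamEmbed₂_lamPart₂_add_muEmbedG_muPartG (x : 𝔼 (m + 2)) :
    lamEmbed₂ m (lamPart₂ m x) + muEmbedG m (muPartG m x) = x := by
  ext i
  rw [PiLp.add_apply, lamEmbed₂_apply, muEmbedG_apply]
  by_cases h : i.val < 2
  · rw [dif_pos h, dif_neg (by omega), add_zero, lamPart₂_apply]
  · rw [dif_neg h, dif_pos (by omega), zero_add, muPartG_apply]
    exact congrArg x (Fin.ext (by simp only; omega))

/-- `⟪(u, 0), (0, v)⟫ = 0`. [folklore] -/
theorem inner_lamEmbed₂_muEmbedG (u : 𝔼 2) (v : 𝔼 m) : ⟪lamEmbed₂ m u, muEmbedG m v⟫ = 0 := by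
  rw [PiLp.inner_apply]
  refine Finset.sum_eq_zero fun i _ => ?_
  rw [lamEmbed₂_apply, muEmbedG_apply]
  by_cases h : i.val < 2
  · rw [dif_pos h, dif_neg (by omega)]; simp
  · rw [dif_neg h]; simp

/-- `‖(u, 0)‖ = ‖u‖`. [folklore] -/
@[simp] theorem norm_lamEmbed₂ (u : 𝔼 2) : ‖lamEmbed₂ m u‖ = ‖u‖ := by
  have h : ‖lamEmbed₂ m u‖ ^ 2 = ‖u‖ ^ 2 := by
    rw [EuclideanSpace.norm_sq_eq, EuclideanSpace.norm_sq_eq]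
    -- the only nonzero coordinates are `0` and `1`
    have hsplit : (Finset.univ : Finset (Fin (m + 2))) =
        (Finset.univ.filter fun i : Fin (m + 2) => i.val < 2) ∪
          (Finset.univ.filter fun i : Fin (m + 2) => ¬ i.val < 2) := by
      ext i; simp; omega
    rw [hsplit, Finset.sum_union (by
      rw [Finset.disjoint_filter]; intro i _ h; exact fun h' => h' h)]
    have h2 : ∑ i ∈ Finset.univ.filter (fun i : Fin (m + 2) => ¬ i.val < 2), ‖lamEmbed₂ m u i‖ ^ 2 = 0 :=
      Finset.sum_eq_zero fun i hi => by
        rw [Finset.mem_filter] at hi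
        rw [lamEmbed₂_apply, dif_neg hi.2]; simp
    rw [h2, add_zero]
    -- reindex the first two coordinates by `Fin 2`
    have hmap : (Finset.univ.filter fun i : Fin (m + 2) => i.val < 2) =
        (Finset.univ : Finset (Fin 2)).map ⟨fun i : Fin 2 => (⟨i.val, by omega⟩ : Fin (m + 2)),
          fun a b hab => Fin.ext (by simpa using congrArg Fin.val hab)⟩ := by
      ext i
      simp only [Finset.mem_filter, Finset.mem_univ, true_and, Finset.mem_map,
        Function.Embedding.coeFn_mk]
      constructor
      · intro hi; exact ⟨⟨i.val, hi⟩, Fin.ext rfl⟩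
      · rintro ⟨j, rfl⟩; exact j.isLt
    rw [hmap, Finset.sum_map]
    refine Finset.sum_congr rfl fun j _ => ?_
    simp only [Function.Embedding.coeFn_mk, lamEmbed₂_apply, j.isLt, dif_pos]
  have h0 := norm_nonneg (lamEmbed₂ m u)
  have h1 := norm_nonneg u
  nlinarith

/-- `‖(0, v)‖ = ‖v‖`. [folklore] -/
@[simp] theorem norm_muEmbedG (v : 𝔼 m) : ‖muEmbedG m v‖ = ‖v‖ := by
  have h : ‖muEmbedG m v‖ ^ 2 = ‖v‖ ^ 2 := by
    rw [EuclideanSpace.norm_sq_eq, EuclideanSpace.norm_sq_eq]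
    have hsplit : (Finset.univ : Finset (Fin (m + 2))) =
        (Finset.univ.filter fun i : Fin (m + 2) => 2 ≤ i.val) ∪
          (Finset.univ.filter fun i : Fin (m + 2) => ¬ 2 ≤ i.val) := by
      ext i; simp; omega
    rw [hsplit, Finset.sum_union (by
      rw [Finset.disjoint_filter]; intro i _ h; exact fun h' => h' h)]
    have h2 : ∑ i ∈ Finset.univ.filter (fun i : Fin (m + 2) => ¬ 2 ≤ i.val), ‖muEmbedG m v i‖ ^ 2 = 0 :=
      Finset.sum_eq_zero fun i hi => by
        rw [Finset.mem_filter] at hi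
        rw [muEmbedG_apply, dif_neg hi.2]; simp
    rw [h2, add_zero]
    have hmap : (Finset.univ.filter fun i : Fin (m + 2) => 2 ≤ i.val) =
        (Finset.univ : Finset (Fin m)).map ⟨fun j : Fin m => (⟨j.val + 2, by omega⟩ : Fin (m + 2)),
          fun a b hab => Fin.ext (by simpa using congrArg Fin.val hab)⟩ := by
      ext i
      simp only [Finset.mem_filter, Finset.mem_univ, true_and, Finset.mem_map,
        Function.Embedding.coeFn_mk]
      constructor
      · intro hi; exact ⟨⟨i.val - 2, by omega⟩, Fin.ext (by simp; omega)⟩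
      · rintro ⟨j, rfl⟩; simp
    rw [hmap, Finset.sum_map]
    refine Finset.sum_congr rfl fun j _ => ?_
    simp only [Function.Embedding.coeFn_mk, muEmbedG_apply]
    rw [dif_pos (by simp)]
    congr 2
  have h0 := norm_nonneg (muEmbedG m v)
  have h1 := norm_nonneg v
  nlinarith

/-- `‖(u, 0) + (0, v)‖² = ‖u‖² + ‖v‖²`. [folklore] -/
theorem norm_lamEmbed₂_add_muEmbedG_sq (u : 𝔼 2) (v : 𝔼 m) :
    ‖lamEmbed₂ m u + muEmbedG m v‖ ^ 2 = ‖u‖ ^ 2 + ‖v‖ ^ 2 := by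
  rw [@norm_add_sq_real, inner_lamEmbed₂_muEmbedG, norm_lamEmbed₂, norm_muEmbedG]; ring

/-- **`‖x‖² = ‖x_λ‖² + ‖x_μ‖²`.** [folklore] -/
theorem norm_sq_eq_lamPart₂_muPartG (x : 𝔼 (m + 2)) :
    ‖x‖ ^ 2 = ‖lamPart₂ m x‖ ^ 2 + ‖muPartG m x‖ ^ 2 := by
  conv_lhs => rw [← lamEmbed₂_lamPart₂_add_muEmbedG_muPartG x]
  exact norm_lamEmbed₂_add_muEmbedG_sq _ _

/-- **`|x_λ|² = ‖x_λ‖²`**: Kosinski's `lamSq 2` is the squared norm of the `λ`-part. [folklore] -/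
theorem lamSq_two_eq (x : 𝔼 (m + 2)) : lamSq 2 x = ‖lamPart₂ m x‖ ^ 2 := by
  rw [EuclideanSpace.norm_sq_eq, lamSq, Fin.sum_univ_two]
  have hfilter : (Finset.univ.filter fun i : Fin (m + 2) => (i : ℕ) < 2) = {0, 1} := by
    ext i
    simp only [Finset.mem_filter, Finset.mem_univ, true_and, Finset.mem_insert,
      Finset.mem_singleton]
    constructor
    · intro h
      have : i.val = 0 ∨ i.val = 1 := by omega
      rcases this with h0 | h1
      · left; exact Fin.ext h0
      · right; exact Fin.ext h1
    · rintro (rfl | rfl) <;> simp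
  rw [hfilter, Finset.sum_pair (by simp)]
  simp [Real.norm_eq_abs, sq_abs]

/-- **`|x_μ|² = ‖x_μ‖²`.** [folklore] -/
theorem muSq_two_eq (x : 𝔼 (m + 2)) : muSq 2 x = ‖muPartG m x‖ ^ 2 := by
  have h := lamSq_add_muSq 2 x
  rw [norm_sq_eq_lamPart₂_muPartG, lamSq_two_eq] at h
  linarith

end Splitting

/-! ### §2 The three coordinates of a point of `T` -/

section Coordinates

variable {m : ℕ}

set_option quotPrecheck false in
/-- Local notation: Kosinski's tube `T ⊆ D^{m+2}` of the circle `S¹ × 0`, as a type. -/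
local notation "𝕋" => ↥(handleTube (m + 1) 2)

variable (m) in
/-- The vector of `ℝ^{m+2}` underlying a point of `T`. [folklore] -/
def tubeVecG (y : 𝕋) : 𝔼 (m + 2) := ((y : 𝔻 (m + 2)) : 𝔼 (m + 2))

/-- Unfolding of `tubeVecG`. [folklore] -/
@[simp] theorem tubeVecG_mk (y : 𝕋) : tubeVecG m y = ((y : 𝔻 (m + 2)) : 𝔼 (m + 2)) := rfl

/-- The coordinate vector is a smooth function on `T`. [folklore] -/
theorem contMDiff_tubeVecG : ContMDiff (𝓡∂ (m + 2)) 𝓘(ℝ, 𝔼 (m + 2)) ∞ (tubeVecG m) :=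
  (contMDiff_coe_closedBall (n := m + 1)).comp contMDiff_subtype_val

/-- Points of `T` lie in the closed unit ball. [folklore] -/
theorem norm_tubeVecG_le_one (y : 𝕋) : ‖tubeVecG m y‖ ≤ 1 :=
  mem_closedBall_zero_iff.1 (y : 𝔻 (m + 2)).2

/-- `|x_λ|² > 0` on `T`. [folklore] -/
theorem lamSq_tubeVecG_pos (y : 𝕋) : 0 < lamSq 2 (tubeVecG m y) :=
  lt_of_le_of_ne (lamSq_nonneg 2 _) (Ne.symm y.2)

/-- `‖x_λ‖ > 0` on `T`. [cite: Kosinski1993, VI §6] -/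
theorem norm_lamPart₂_tubeVecG_pos (y : 𝕋) : 0 < ‖lamPart₂ m (tubeVecG m y)‖ := by
  have h := lamSq_tubeVecG_pos y
  rw [lamSq_two_eq] at h
  exact lt_of_le_of_ne (norm_nonneg _) fun h0 => by rw [← h0] at h; norm_num at h

variable (m) in
/-- **The angle coordinate** `x_λ/|x_λ| ∈ S¹`. [cite: Kosinski1993, VI §6] -/
def tubeAngleG (y : 𝕋) : 𝕊 1 :=
  ⟨‖lamPart₂ m (tubeVecG m y)‖⁻¹ • lamPart₂ m (tubeVecG m y), by
    rw [mem_sphere_zero_iff_norm, norm_smul, norm_inv, norm_norm,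
      inv_mul_cancel₀ (norm_lamPart₂_tubeVecG_pos y).ne']⟩

/-- The underlying vector of the angle. [folklore] -/
@[simp] theorem coe_tubeAngleG (y : 𝕋) :
    (tubeAngleG m y : 𝔼 2) = ‖lamPart₂ m (tubeVecG m y)‖⁻¹ • lamPart₂ m (tubeVecG m y) := rfl

variable (m) in
/-- **The fibre coordinate** `x_μ ∈ ℝᵐ`. [cite: Kosinski1993, VI §6] -/
def tubeFibreG (y : 𝕋) : 𝔼 m := muPartG m (tubeVecG m y)

variable (m) in
/-- **The depth coordinate** `1 - ‖x‖² ∈ [0, 1)`. [folklore] -/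
def tubeDepthG (y : 𝕋) : ℝ := 1 - ‖tubeVecG m y‖ ^ 2

/-- The depth is nonnegative. [folklore] -/
theorem tubeDepthG_nonneg (y : 𝕋) : 0 ≤ tubeDepthG m y := by
  have h := norm_tubeVecG_le_one y
  unfold tubeDepthG
  nlinarith [norm_nonneg (tubeVecG m y)]

/-- **The fundamental relation** `‖x_λ‖² = 1 - depth - ‖x_μ‖²`. [folklore] -/
theorem norm_lamPart₂_sq_eq (y : 𝕋) :
    ‖lamPart₂ m (tubeVecG m y)‖ ^ 2 = 1 - tubeDepthG m y - ‖tubeFibreG m y‖ ^ 2 := by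
  rw [tubeDepthG, tubeFibreG, norm_sq_eq_lamPart₂_muPartG (tubeVecG m y)]; ring

/-- `depth + ‖x_μ‖² < 1` on `T`. [folklore] -/
theorem tubeDepthG_add_norm_tubeFibreG_sq_lt_one (y : 𝕋) :
    tubeDepthG m y + ‖tubeFibreG m y‖ ^ 2 < 1 := by
  have h := norm_lamPart₂_sq_eq y
  have h' := norm_lamPart₂_tubeVecG_pos y
  nlinarith

/-- The depth is `< 1` on `T`. [folklore] -/
theorem tubeDepthG_lt_one (y : 𝕋) : tubeDepthG m y < 1 := by
  linarith [tubeDepthG_add_norm_tubeFibreG_sq_lt_one y, sq_nonneg ‖tubeFibreG m y‖]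

/-- `‖x_μ‖ < 1` on `T`. [folklore] -/
theorem norm_tubeFibreG_lt_one (y : 𝕋) : ‖tubeFibreG m y‖ < 1 := by
  have h := tubeDepthG_add_norm_tubeFibreG_sq_lt_one y
  have h0 := tubeDepthG_nonneg y
  nlinarith [norm_nonneg (tubeFibreG m y)]

/-- The depth vanishes exactly on the boundary sphere. [folklore] -/
theorem tubeDepthG_eq_zero_iff (y : 𝕋) : tubeDepthG m y = 0 ↔ ‖tubeVecG m y‖ = 1 := by
  unfold tubeDepthG
  constructor
  · intro h
    have h1 : ‖tubeVecG m y‖ ^ 2 = 1 := by linarith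
    nlinarith [norm_nonneg (tubeVecG m y)]
  · intro h; rw [h]; ring

/-- The depth coordinate is smooth on `T`. [folklore] -/
theorem contMDiff_tubeDepthG : ContMDiff (𝓡∂ (m + 2)) 𝓘(ℝ, ℝ) ∞ (tubeDepthG m) :=
  (contDiff_const.sub (contDiff_norm_sq ℝ)).contMDiff.comp contMDiff_tubeVecG

/-- The fibre coordinate is smooth on `T`. [folklore] -/
theorem contMDiff_tubeFibreG : ContMDiff (𝓡∂ (m + 2)) 𝓘(ℝ, 𝔼 m) ∞ (tubeFibreG m) :=
  (muPartG m).contDiff.contMDiff.comp contMDiff_tubeVecG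

/-- The angle, as a vector of `ℝ²`, is smooth on `T`. [folklore] -/
theorem contMDiff_coe_tubeAngleG :
    ContMDiff (𝓡∂ (m + 2)) 𝓘(ℝ, 𝔼 2) ∞ fun y => (tubeAngleG m y : 𝔼 2) := by
  intro y
  have h1 : ContMDiffAt (𝓡∂ (m + 2)) 𝓘(ℝ, 𝔼 2) ∞ (fun y => lamPart₂ m (tubeVecG m y)) y :=
    ((lamPart₂ m).contDiff.contMDiff.comp contMDiff_tubeVecG) y
  have h2 : ContDiffAt ℝ ∞ (fun u : 𝔼 2 => ‖u‖⁻¹ • u) (lamPart₂ m (tubeVecG m y)) :=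
    ((contDiffAt_norm ℝ (norm_pos_iff.1 (norm_lamPart₂_tubeVecG_pos y))).inv
      (norm_lamPart₂_tubeVecG_pos y).ne').smul contDiffAt_id
  exact (h2.contMDiffAt.comp y h1).congr_of_eventuallyEq (Filter.Eventually.of_forall fun _ => rfl)

/-- **The angle coordinate is smooth** `T → S¹`. [cite: Kosinski1993, VI §6] -/
theorem contMDiff_tubeAngleG : ContMDiff (𝓡∂ (m + 2)) (𝓡 1) ∞ (tubeAngleG m) :=
  contMDiff_coe_tubeAngleG.codRestrict_sphere fun y => (tubeAngleG m y).2

end Coordinates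

/-! ### §3 Reconstruction: the point of `T` with prescribed coordinates -/

section Reconstruction

variable {m : ℕ}

set_option quotPrecheck false in
/-- Local notation: Kosinski's tube `T ⊆ D^{m+2}` of the circle `S¹ × 0`, as a type. -/
local notation "𝕋" => ↥(handleTube (m + 1) 2)

variable (m) in
/-- The vector with angle `θ`, fibre `v` and depth `s`:
`(1 - s - ‖v‖²)^{1/2} (θ, 0) + (0, v)`. [folklore] -/
def mkVecG (θ : 𝔼 2) (v : 𝔼 m) (s : ℝ) : 𝔼 (m + 2) :=
  Real.sqrt (1 - s - ‖v‖ ^ 2) • lamEmbed₂ m θ + muEmbedG m v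

/-- The `λ`-part of `mkVecG θ v s`. [folklore] -/
theorem lamPart₂_mkVecG (θ : 𝔼 2) (v : 𝔼 m) (s : ℝ) :
    lamPart₂ m (mkVecG m θ v s) = Real.sqrt (1 - s - ‖v‖ ^ 2) • θ := by
  rw [mkVecG, map_add, map_smul, lamPart₂_lamEmbed₂, lamPart₂_muEmbedG, add_zero]

/-- The `μ`-part of `mkVecG θ v s` is `v`. [folklore] -/
@[simp] theorem muPartG_mkVecG (θ : 𝔼 2) (v : 𝔼 m) (s : ℝ) : muPartG m (mkVecG m θ v s) = v := by
  rw [mkVecG, map_add, map_smul, muPartG_lamEmbed₂, smul_zero, zero_add, muPartG_muEmbedG]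

/-- `‖mkVecG θ v s‖² = 1 - s` for a unit `θ` and `1 - s - ‖v‖² ≥ 0`. [folklore] -/
theorem norm_mkVecG_sq (θ : 𝕊 1) (v : 𝔼 m) {s : ℝ} (h : 0 ≤ 1 - s - ‖v‖ ^ 2) :
    ‖mkVecG m (θ : 𝔼 2) v s‖ ^ 2 = 1 - s := by
  rw [mkVecG, ← map_smul, norm_lamEmbed₂_add_muEmbedG_sq, norm_smul, Real.norm_eq_abs,
    abs_of_nonneg (Real.sqrt_nonneg _), norm_eq_of_mem_sphere θ, mul_one, Real.sq_sqrt h]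
  ring

/-- `|x_λ|² = 1 - s - ‖v‖²` for `mkVecG`. [folklore] -/
theorem lamSq_mkVecG (θ : 𝕊 1) (v : 𝔼 m) {s : ℝ} (h : 0 ≤ 1 - s - ‖v‖ ^ 2) :
    lamSq 2 (mkVecG m (θ : 𝔼 2) v s) = 1 - s - ‖v‖ ^ 2 := by
  rw [lamSq_two_eq, lamPart₂_mkVecG, norm_smul, Real.norm_eq_abs,
    abs_of_nonneg (Real.sqrt_nonneg _), norm_eq_of_mem_sphere θ, mul_one, Real.sq_sqrt h]

/-- `mkVecG θ v s` lies in the closed unit ball for `0 ≤ s` and `1 - s - ‖v‖² ≥ 0`. [folklore] -/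
theorem mkVecG_mem_closedBall (θ : 𝕊 1) (v : 𝔼 m) {s : ℝ} (hs : 0 ≤ s)
    (h : 0 ≤ 1 - s - ‖v‖ ^ 2) : mkVecG m (θ : 𝔼 2) v s ∈ 𝔻 (m + 2) := by
  rw [mem_closedBall_zero_iff]
  have h1 := norm_mkVecG_sq θ v h
  nlinarith [norm_nonneg (mkVecG m (θ : 𝔼 2) v s)]

variable (m) in
/-- **The point of `T` with angle `θ`, fibre `v` and depth `s`** (`0 ≤ s`,
`1 - s - ‖v‖² > 0`). [folklore] -/
def mkTubePtG (θ : 𝕊 1) (v : 𝔼 m) (s : ℝ) (hs : 0 ≤ s) (h : 0 < 1 - s - ‖v‖ ^ 2) : 𝕋 :=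
  ⟨⟨mkVecG m (θ : 𝔼 2) v s, mkVecG_mem_closedBall θ v hs h.le⟩, by
    rw [mem_handleTube]
    show lamSq 2 (mkVecG m (θ : 𝔼 2) v s) ≠ 0
    rw [lamSq_mkVecG θ v h.le]
    exact h.ne'⟩

/-- The underlying vector of `mkTubePtG`. [folklore] -/
@[simp] theorem tubeVecG_mkTubePtG (θ : 𝕊 1) (v : 𝔼 m) (s : ℝ) (hs : 0 ≤ s)
    (h : 0 < 1 - s - ‖v‖ ^ 2) : tubeVecG m (mkTubePtG m θ v s hs h) = mkVecG m (θ : 𝔼 2) v s := rfl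

/-- The fibre coordinate of `mkTubePtG θ v s` is `v`. [folklore] -/
@[simp] theorem tubeFibreG_mkTubePtG (θ : 𝕊 1) (v : 𝔼 m) (s : ℝ) (hs : 0 ≤ s)
    (h : 0 < 1 - s - ‖v‖ ^ 2) : tubeFibreG m (mkTubePtG m θ v s hs h) = v :=
  muPartG_mkVecG _ _ _

/-- The depth of `mkTubePtG θ v s` is `s`. [folklore] -/
@[simp] theorem tubeDepthG_mkTubePtG (θ : 𝕊 1) (v : 𝔼 m) (s : ℝ) (hs : 0 ≤ s)
    (h : 0 < 1 - s - ‖v‖ ^ 2) : tubeDepthG m (mkTubePtG m θ v s hs h) = s := by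
  rw [tubeDepthG, tubeVecG_mkTubePtG, norm_mkVecG_sq θ v h.le]; ring

/-- The angle of `mkTubePtG θ v s` is `θ`. [folklore] -/
@[simp] theorem tubeAngleG_mkTubePtG (θ : 𝕊 1) (v : 𝔼 m) (s : ℝ) (hs : 0 ≤ s)
    (h : 0 < 1 - s - ‖v‖ ^ 2) : tubeAngleG m (mkTubePtG m θ v s hs h) = θ := by
  apply Subtype.ext
  have hr : 0 < Real.sqrt (1 - s - ‖v‖ ^ 2) := Real.sqrt_pos.2 h
  rw [coe_tubeAngleG, tubeVecG_mkTubePtG, lamPart₂_mkVecG, norm_smul, Real.norm_eq_abs,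
    abs_of_pos hr, norm_eq_of_mem_sphere θ, mul_one, smul_smul, inv_mul_cancel₀ hr.ne', one_smul]

/-- **Reconstruction**: the point of `T` with the coordinates of `y` is `y`. [folklore] -/
theorem mkVecG_tube (y : 𝕋) :
    mkVecG m (tubeAngleG m y : 𝔼 2) (tubeFibreG m y) (tubeDepthG m y) = tubeVecG m y := by
  have hpos := norm_lamPart₂_tubeVecG_pos y
  have hsq : Real.sqrt (1 - tubeDepthG m y - ‖tubeFibreG m y‖ ^ 2) = ‖lamPart₂ m (tubeVecG m y)‖ := by
    rw [← norm_lamPart₂_sq_eq, Real.sqrt_sq (norm_nonneg _)]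
  rw [mkVecG, hsq, coe_tubeAngleG, map_smul, smul_smul, mul_inv_cancel₀ hpos.ne', one_smul,
    tubeFibreG, lamEmbed₂_lamPart₂_add_muEmbedG_muPartG]

/-- The point of `T` with the coordinates of `y` is `y` (as points of `T`). [folklore] -/
theorem mkTubePtG_tube (y : 𝕋) (hs : 0 ≤ tubeDepthG m y)
    (h : 0 < 1 - tubeDepthG m y - ‖tubeFibreG m y‖ ^ 2) :
    mkTubePtG m (tubeAngleG m y) (tubeFibreG m y) (tubeDepthG m y) hs h = y :=
  Subtype.ext (Subtype.ext (mkVecG_tube y))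

variable {EZ : Type*} [NormedAddCommGroup EZ] [NormedSpace ℝ EZ] {HZ : Type*} [TopologicalSpace HZ]
  {J : ModelWithCorners ℝ EZ HZ} {Z : Type*} [TopologicalSpace Z] [ChartedSpace HZ Z]

/-- **`mkVecG` is smooth in its three arguments along smooth maps, where `1 - s - ‖v‖² > 0`.**
[folklore] -/
theorem contMDiffOn_mkVecG {a : Z → 𝔼 2} {v : Z → 𝔼 m} {s : Z → ℝ} {U : Set Z}
    (ha : ContMDiffOn J 𝓘(ℝ, 𝔼 2) ∞ a U) (hv : ContMDiffOn J 𝓘(ℝ, 𝔼 m) ∞ v U)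
    (hs : ContMDiffOn J 𝓘(ℝ, ℝ) ∞ s U) (hpos : ∀ z ∈ U, 0 < 1 - s z - ‖v z‖ ^ 2) :
    ContMDiffOn J 𝓘(ℝ, 𝔼 (m + 2)) ∞ (fun z => mkVecG m (a z) (v z) (s z)) U := by
  have hℓ : ContMDiffOn J 𝓘(ℝ, ℝ) ∞ (fun z => 1 - s z - ‖v z‖ ^ 2) U :=
    (contMDiffOn_const.sub hs).sub ((contDiff_norm_sq ℝ).contMDiff.comp_contMDiffOn hv)
  have hsqrt : ContMDiffOn J 𝓘(ℝ, ℝ) ∞ (fun z => Real.sqrt (1 - s z - ‖v z‖ ^ 2)) U := by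
    intro z hz
    have h1 : ContDiffAt ℝ ∞ Real.sqrt (1 - s z - ‖v z‖ ^ 2) :=
      Real.contDiffAt_sqrt (hpos z hz).ne'
    exact h1.contMDiffAt.comp_contMDiffWithinAt z (hℓ z hz)
  have h1 : ContMDiffOn J 𝓘(ℝ, 𝔼 (m + 2)) ∞ (fun z => lamEmbed₂ m (a z)) U :=
    (lamEmbed₂ m).contDiff.contMDiff.comp_contMDiffOn ha
  have h2 : ContMDiffOn J 𝓘(ℝ, 𝔼 (m + 2)) ∞ (fun z => muEmbedG m (v z)) U :=
    (muEmbedG m).contDiff.contMDiff.comp_contMDiffOn hv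
  exact (hsqrt.smul h1).add h2

end Reconstruction

end Literature.Topology.FourManifolds

end
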